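import Summits.QuantumFields.YangMills.Theorems.BalabanUVNodesN20BlockCaricatureSummableStatistic

/-!
# BalabanUVNodes ∕ N20·N19′·N21 — THE EXACT CRITERION OF THE INDEPENDENT-BLOCK CARICATURE (FILE D): node U5's bundled binder list `HybridNE7` (hence K3⁷ v5 stub 2's face triple)
# holds on the caricature carriers for SOME dials IFF the ℓ¹ distances of the two runs' configuration laws are SUMMABLE over scales, `Σ_K Σ_{S ⊆ range n_K} |A_S − B_S| < ∞`;
# and the DICTIONARY with the Hellinger road: `Σ_K (1 − bc_K) < ∞ ⟺ Σ_K Λ_K < ∞`, `Σ_K H_K < ∞ ⟺ Σ_K √Λ_K < ∞` — CRIT-1's «one measurement serves both cards» as a theorem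

Cell `pub-ymgap` (HUMAN RULING D-0062 Track A; work-bound push D-0149, director-ym №197), width seat `pub-ymgap-dag-n20-w1` (gen 5) on node N20 = NE7b; key item K3⁷
`SpineGivenEndpointR13SepCoPH` = stmt-QuantumFields-20544 (`--kind proof --supports 20544 --as helper`); COUNT-NEUTRAL.  Bus: CLAIM-11 ∕ INTENT-15 (INBOX l.31315).
THEOREMS ONLY: no `def`, no `instance`, no `notation`, no `sorry`; imports this seat's FILE C `…N20BlockCaricatureSummableStatistic` (through it FILES A∕B, dag-n19-w4 p608854 and
dag-n20-w4 p607565 ∕ p609004: `exists_tvRadius_of_hybridNE7`, `exists_hybridNE7_of_target_of_classLawTV`, CONSUMED BY NAME).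

WHY.  FILES B∕C bracketed the caricature's stub-2 criterion by CRIT-1's statistic: `Σ_K Λ_K < ∞` NECESSARY, `Σ_K √Λ_K < ∞` SUFFICIENT.  The EXACT currency in between is the TOTAL
VARIATION sequence itself (dag-n20-w4's `exists_hybridNE7_iff_target_and_classLawTV` at generic carriers: `HybridNE7` for some dials ⟺ node U5's `Target` ∧ a summable class-law TV
radius `< 1`).  On the caricature the target is FREE (totals `≡ 1`) and the TV radius has a CLOSED FORM — half the ℓ¹ distance `½ Σ_{S ⊆ range n} |p^{#S}(1−p)^{n−#S} − q^{#S}(1−q)^{n−#S}|`,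
attained on the Hahn set `{A < B}` (§1 `sum_abs_sub_eq_two_mul_hahnGap`) and `< 1` as soon as `p ∈ (0, 1)` — so the criterion becomes EXACT and dial-free (★★★ §3
`exists_hybridNE7_caricature_iff_summable_l1`; face-triple edition ★★ `faces_caricature_iff_summable_l1`): THE THREE FACES OF STUB 2 ARE SERVABLE ON THE CARICATURE IFF
`Σ_K ‖Bin-config(n_K, p_K) − Bin-config(n_K, q_K)‖₁ < ∞`.  §4 is the DICTIONARY with ym-nodeO idea-3's `hellinger-free-energy-road` (ed. 2; CRIT-1 triage Rec. (c) «dag-n20∕cdisprove: the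
measurable instance remains window-key-core ed.2's (LS)∕λ_K statistic = 2Δ_K here — one measurement serves both cards»): on the caricature the affinity defect `Δ_K = 1 − bc_K = 1 − u_K^{n_K}`
(FILE A `affinity_config_eq_pow`) obeys `1 − e^{−Λ_K∕4} ≤ Δ_K ≤ Λ_K∕2`, whence `Σ Δ_K < ∞ ⟺ Σ Λ_K < ∞` (the road's NECESSITY letter `Σ(1 − bc) < ∞` = FILE C's) and
`Σ √Δ_K < ∞ ⟺ Σ √Λ_K < ∞` (the road's binding letter (V) `Σ H_K < ∞` = FILE C's sufficiency letter) — the ℓ¹∕ℓ^{1∕2} squeeze of FILES B∕C IS Le Cam's `H² ≤ TV ≤ √2·H` gap, no more,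
no less; and the ℓ¹ distance is bracketed `2Δ_K ≤ ℓ¹_K ≤ 2√(1 − (1 − Δ_K)²)` (§2).
* §1 two finite laws [folklore]: ★ `sum_abs_sub_eq_two_mul_hahnGap` (equal totals ⇒ `Σ|b − a| = 2·(b − a)({a < b})`) · `hahnGap_lt_one_of_pos` (all `a > 0`, unit totals ⇒ the Hahn gap is `< 1`).
* §2 the caricature, one step [folklore]: `hahnGap_config_ge_one_sub_affinity_pow` · `l1_config_ge_two_mul_defect` · `l1_config_le_two_mul_sqrt` · `half_l1_config_lt_one`.
* §3 along `K` [folklore ∕ bookkeeping]: ★★★ `exists_hybridNE7_caricature_iff_summable_l1` · ★★ `faces_caricature_iff_summable_l1`.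
* §4 dictionary [folklore]: `one_sub_affinity_pow_le_half_stat` · `one_sub_exp_neg_le_defect` · ★ `summable_defect_iff_summable_stat` · ★ `summable_sqrt_defect_iff_summable_sqrt_stat`.

HONEST FRAMING.  [folklore] finite-sum probability ∕ real analysis on a CARICATURE (independent blocks, product Bernoulli class weights — the card's simplification); nothing read at
the record (`classSet₁₃ ∕ weightA₁₃ ∕ weightB₁₃` untouched; (LS)∕(XG′)∕(SAT′) at the record UNDECIDED); proves NO estimate of Bałaban's; refutes NO registered stub; nothing of Bałaban's
asserted or instantiated.  NE7 ∕ NE7b ∕ NE7c NOT PRINTED for `d = 4`, NOT proved; N19 ∕ N20 ∕ N21 NOT discharged; K3⁷ OPEN, skeleton v5 941dddb108cbaacf STANDS; counts unmoved (typed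
28∕28 · discharged 5∕27); no count claim.  One finite `𝕋⁴_{L^K}` programme at fixed `ε = L^{−K}`, Bałaban AS PRINTED; the YM mass gap (Clay) is NOT proved by any of this — R4 closes the
conditional finite-𝕋⁴ rung `BalabanLadder.UV` only; NOT ℝ⁴, NOT OS.  Sources (bookkeeping only): [Balaban1988Convergent] (1.1) p.244, (2.18) p.257; [Balaban1989LargeFieldII] (1.80)
p.384.  No decl carries a cite tag.
-/

set_option autoImplicit false

noncomputable section

open Finset Filter Topology
open Literature.MathematicalPhysics.QuantumFieldTheory.Balaban1983to89
open Literature.MathematicalPhysics.QuantumFieldTheory.Balaban1983to89.T4WeightBudget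
open Literature.MathematicalPhysics.QuantumFieldTheory.Balaban1983to89.T4IndicatorShell
open Literature.MathematicalPhysics.QuantumFieldTheory.Balaban1983to89.T4MatchingAssembly (HybridNE7)
open Summit.QuantumFields.BalabanUV.T4Continuum.Spine.NE7
open Summit.QuantumFields.YangMills.BalabanUVNodes.N20BlockCaricatureAffinity
open Summit.QuantumFields.YangMills.BalabanUVNodes.N20BlockCaricatureLawSeparation (one_sub_affinity_pow_le_stat)
open Summit.QuantumFields.YangMills.BalabanUVNodes.N20BlockCaricatureSummableStatistic (summable_classLawGap_of_faces affinity₁_pos)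
open Summit.QuantumFields.YangMills.BalabanUVNodes.N20HybridClassLawCharacterisation (exists_tvRadius_of_hybridNE7 exists_hybridNE7_of_target_of_classLawTV)

namespace Summit.QuantumFields.YangMills.BalabanUVNodes.N20BlockCaricatureExactCriterion

/-! ## §1 Two finite laws: the ℓ¹ distance is twice the Hahn-set gap; positive weights make the gap `< 1` -/

section TwoLaws

variable {ι : Type*} (T : Finset ι) {a b : ι → ℝ}

/-- ★ **ℓ¹ = 2 × HAHN GAP** [folklore]: for weight functions with equal totals on `T`, `Σ_T |b − a| = 2·(Σ_{a<b} b − Σ_{a<b} a)` (the positive and negative parts of `b − a` have equal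
sums). -/
theorem sum_abs_sub_eq_two_mul_hahnGap [DecidablePred fun i => a i < b i] (hab : ∑ i ∈ T, a i = ∑ i ∈ T, b i) :
    ∑ i ∈ T, |b i - a i| = 2 * (∑ i ∈ T.filter (fun i => a i < b i), b i - ∑ i ∈ T.filter (fun i => a i < b i), a i) := by
  have hpos : ∑ i ∈ T.filter (fun i => a i < b i), |b i - a i| = ∑ i ∈ T.filter (fun i => a i < b i), (b i - a i) :=
    Finset.sum_congr rfl fun i hi => abs_of_pos (sub_pos.2 (Finset.mem_filter.1 hi).2)
  have hneg : ∑ i ∈ T.filter (fun i => ¬ a i < b i), |b i - a i| = -∑ i ∈ T.filter (fun i => ¬ a i < b i), (b i - a i) := by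
    rw [← Finset.sum_neg_distrib]
    exact Finset.sum_congr rfl fun i hi => by
      rw [abs_of_nonpos (sub_nonpos.2 (not_lt.1 (Finset.mem_filter.1 hi).2))]
  have h0 : ∑ i ∈ T, (b i - a i) = 0 := by rw [Finset.sum_sub_distrib]; linarith
  have hsplit := Finset.sum_filter_add_sum_filter_not T (fun i => a i < b i) (fun i => b i - a i)
  have hsplit' := Finset.sum_filter_add_sum_filter_not T (fun i => a i < b i) (fun i => |b i - a i|)
  rw [h0] at hsplit
  rw [← hsplit', hpos, hneg, ← Finset.sum_sub_distrib]
  linarith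

/-- Positive `a`-weights with unit total make the Hahn gap STRICTLY below one (the `a`-mass of `{a < b}` is positive unless that set is empty, where the gap is `0`). [folklore] -/
theorem hahnGap_lt_one_of_pos [DecidablePred fun i => a i < b i] (ha : ∀ i ∈ T, 0 < a i) (hb : ∀ i ∈ T, 0 ≤ b i) (hbT : ∑ i ∈ T, b i = 1) :
    ∑ i ∈ T.filter (fun i => a i < b i), b i - ∑ i ∈ T.filter (fun i => a i < b i), a i < 1 := by
  have hbS : ∑ i ∈ T.filter (fun i => a i < b i), b i ≤ 1 :=
    hbT ▸ Finset.sum_le_sum_of_subset_of_nonneg (Finset.filter_subset _ _) fun i hi _ => hb i hi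
  rcases (T.filter (fun i => a i < b i)).eq_empty_or_nonempty with h | h
  · rw [h]; simp
  · have haS : 0 < ∑ i ∈ T.filter (fun i => a i < b i), a i := Finset.sum_pos (fun i hi => ha i (Finset.mem_filter.1 hi).1) h
    linarith

end TwoLaws

/-! ## §2 The caricature, one step: the ℓ¹ distance of the two configuration laws against the affinity defect -/

section OneStep

variable {p q : ℝ}

/-- On the caricature the Hahn set `{A < B}` has gap `≥ 1 − u^n` (`u` the per-block affinity; FILE A at `BC = u^n`). [folklore] -/
theorem hahnGap_config_ge_one_sub_affinity_pow (hp0 : 0 ≤ p) (hq0 : 0 ≤ q) (hp1 : p ≤ 1) (hq1 : q ≤ 1) (n : ℕ) :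
    1 - (Real.sqrt (p * q) + Real.sqrt ((1 - p) * (1 - q))) ^ n ≤
      ∑ S ∈ (Finset.range n).powerset.filter (fun S => p ^ S.card * (1 - p) ^ (n - S.card) < q ^ S.card * (1 - q) ^ (n - S.card)), q ^ S.card * (1 - q) ^ (n - S.card) -
      ∑ S ∈ (Finset.range n).powerset.filter (fun S => p ^ S.card * (1 - p) ^ (n - S.card) < q ^ S.card * (1 - q) ^ (n - S.card)), p ^ S.card * (1 - p) ^ (n - S.card) := by
  classical
  -- FILE A's witness IS the Hahn set (its proof chose `T.filter (a < b)`); re-derive the identity `gap(Hahn) = 1 − Σ min ≥ 1 − BC`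
  have key : ∑ S ∈ (Finset.range n).powerset.filter (fun S => p ^ S.card * (1 - p) ^ (n - S.card) < q ^ S.card * (1 - q) ^ (n - S.card)), q ^ S.card * (1 - q) ^ (n - S.card) -
      ∑ S ∈ (Finset.range n).powerset.filter (fun S => p ^ S.card * (1 - p) ^ (n - S.card) < q ^ S.card * (1 - q) ^ (n - S.card)), p ^ S.card * (1 - p) ^ (n - S.card) =
      ∑ S ∈ (Finset.range n).powerset, q ^ S.card * (1 - q) ^ (n - S.card) -
      ∑ S ∈ (Finset.range n).powerset, min (p ^ S.card * (1 - p) ^ (n - S.card)) (q ^ S.card * (1 - q) ^ (n - S.card)) := by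
    rw [← Finset.sum_sub_distrib, ← Finset.sum_sub_distrib, Finset.sum_filter]
    refine Finset.sum_congr rfl fun S _ => ?_
    split_ifs with h
    · rw [min_eq_left h.le]
    · rw [min_eq_right (not_lt.1 h), sub_self]
  rw [key, sum_config_eq_one, ← affinity_config_eq_pow hp0 hq0 hp1 hq1 n]
  linarith [sum_min_le_affinity (Finset.range n).powerset (a := fun S => p ^ S.card * (1 - p) ^ (n - S.card)) (b := fun S => q ^ S.card * (1 - q) ^ (n - S.card))
    (fun S _ => config_nonneg hp0 hp1 n S) (fun S _ => config_nonneg hq0 hq1 n S)]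

/-- **LOWER ℓ¹ BRACKET**: `2·(1 − u^n) ≤ Σ_S |A_S − B_S|` (the affinity defect `Δ = 1 − bc` under-estimates half the ℓ¹ distance — Le Cam's `H² ≤ TV`). [folklore] -/
theorem l1_config_ge_two_mul_defect (hp0 : 0 ≤ p) (hq0 : 0 ≤ q) (hp1 : p ≤ 1) (hq1 : q ≤ 1) (n : ℕ) :
    2 * (1 - (Real.sqrt (p * q) + Real.sqrt ((1 - p) * (1 - q))) ^ n) ≤
      ∑ S ∈ (Finset.range n).powerset, |q ^ S.card * (1 - q) ^ (n - S.card) - p ^ S.card * (1 - p) ^ (n - S.card)| := by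
  classical
  rw [sum_abs_sub_eq_two_mul_hahnGap (Finset.range n).powerset (a := fun S => p ^ S.card * (1 - p) ^ (n - S.card))
    (b := fun S => q ^ S.card * (1 - q) ^ (n - S.card)) (by rw [sum_config_eq_one, sum_config_eq_one])]
  linarith [hahnGap_config_ge_one_sub_affinity_pow hp0 hq0 hp1 hq1 n]

/-- **UPPER ℓ¹ BRACKET**: `Σ_S |A_S − B_S| ≤ 2·√(1 − u^{2n})` (Le Cam's `TV ≤ √(1 − bc²)` at the Hahn set, FILE A). [folklore] -/
theorem l1_config_le_two_mul_sqrt (hp0 : 0 ≤ p) (hq0 : 0 ≤ q) (hp1 : p ≤ 1) (hq1 : q ≤ 1) (n : ℕ) :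
    ∑ S ∈ (Finset.range n).powerset, |q ^ S.card * (1 - q) ^ (n - S.card) - p ^ S.card * (1 - p) ^ (n - S.card)| ≤
      2 * Real.sqrt (1 - (Real.sqrt (p * q) + Real.sqrt ((1 - p) * (1 - q))) ^ (n * 2)) := by
  classical
  rw [sum_abs_sub_eq_two_mul_hahnGap (Finset.range n).powerset (a := fun S => p ^ S.card * (1 - p) ^ (n - S.card))
    (b := fun S => q ^ S.card * (1 - q) ^ (n - S.card)) (by rw [sum_config_eq_one, sum_config_eq_one])]
  have h := abs_sub_le_sqrt_one_sub_affinity_sq (Finset.range n).powerset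
    (a := fun S => p ^ S.card * (1 - p) ^ (n - S.card)) (b := fun S => q ^ S.card * (1 - q) ^ (n - S.card))
    (fun S _ => config_nonneg hp0 hp1 n S) (fun S _ => config_nonneg hq0 hq1 n S) (sum_config_eq_one p n) (sum_config_eq_one q n) (Finset.filter_subset _ _)
    (S := (Finset.range n).powerset.filter (fun S => p ^ S.card * (1 - p) ^ (n - S.card) < q ^ S.card * (1 - q) ^ (n - S.card)))
  rw [affinity_config_eq_pow hp0 hq0 hp1 hq1 n, ← pow_mul] at h
  linarith [le_abs_self (∑ S ∈ (Finset.range n).powerset.filter (fun S => p ^ S.card * (1 - p) ^ (n - S.card) < q ^ S.card * (1 - q) ^ (n - S.card)),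
      q ^ S.card * (1 - q) ^ (n - S.card) -
    ∑ S ∈ (Finset.range n).powerset.filter (fun S => p ^ S.card * (1 - p) ^ (n - S.card) < q ^ S.card * (1 - q) ^ (n - S.card)), p ^ S.card * (1 - p) ^ (n - S.card))]

/-- Half the ℓ¹ distance of the two configuration laws is STRICTLY below one once `p ∈ (0, 1)` (all run-A weights positive). [folklore] -/
theorem half_l1_config_lt_one (hp0 : 0 < p) (hp1 : p < 1) (hq0 : 0 ≤ q) (hq1 : q ≤ 1) (n : ℕ) :
    (∑ S ∈ (Finset.range n).powerset, |q ^ S.card * (1 - q) ^ (n - S.card) - p ^ S.card * (1 - p) ^ (n - S.card)|) / 2 < 1 := by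
  classical
  rw [sum_abs_sub_eq_two_mul_hahnGap (Finset.range n).powerset (a := fun S => p ^ S.card * (1 - p) ^ (n - S.card))
    (b := fun S => q ^ S.card * (1 - q) ^ (n - S.card)) (by rw [sum_config_eq_one, sum_config_eq_one])]
  have h := hahnGap_lt_one_of_pos (Finset.range n).powerset (a := fun S => p ^ S.card * (1 - p) ^ (n - S.card))
    (b := fun S => q ^ S.card * (1 - q) ^ (n - S.card)) (fun S _ => mul_pos (pow_pos hp0 _) (pow_pos (by linarith) _))
    (fun S _ => config_nonneg hq0 hq1 n S) (sum_config_eq_one q n)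
  linarith

end OneStep

/-! ## §3 Along `K`: the EXACT criterion — `HybridNE7` (hence the face triple) for some dials ⟺ the ℓ¹ distances are summable -/

section AlongK

variable (n : ℕ → ℕ) (p q : ℕ → ℝ)

/-- ★★★ **THE EXACT CRITERION OF THE CARICATURE** [folklore ∕ bookkeeping]: for `p_K ∈ (0, 1)`, `q_K ∈ [0, 1]`: SOME `(Bad, W, shA, shB, Wsh, δ)` give node U5's
bundled binder list `HybridNE7` on the caricature carriers (any `vol`, any `l₀ ≥ 0`) IFF `Σ_K Σ_{S ⊆ range n_K} |A_S − B_S| < ∞`.  (⇒) dag-n20-w4's `exists_tvRadius_of_hybridNE7` (a summable class-law TV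
radius for every set) read on the Hahn sets, where the gap is half the ℓ¹ distance (§1); (⇐) the radius `ρ_K := ½ℓ¹_K` bounds every class-set gap (FILE A `abs_sub_le_half_sum_abs`),
is `< 1` (§2) and summable, the target is free (totals `≡ 1`), and dag-n20-w4's `exists_hybridNE7_of_target_of_classLawTV` pays it as SHELL WEIGHT with NO bad class. -/
theorem exists_hybridNE7_caricature_iff_summable_l1 (hp : ∀ K, 0 < p K ∧ p K < 1) (hq : ∀ K, 0 ≤ q K ∧ q K ≤ 1)
    {l₀ : ℝ} (hl₀ : 0 ≤ l₀) (vol : ℝ) :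
    (∃ (Bad : ℕ → ℝ → Finset (Finset ℕ)) (W : ℕ → ℝ) (shA shB : ℕ → ℝ → Finset ℕ → ℝ) (Wsh δ : ℕ → ℝ),
      HybridNE7 l₀ vol (fun K => (Finset.range (n K)).powerset) (fun K _ S => p K ^ S.card * (1 - p K) ^ (n K - S.card))
        (fun K _ S => q K ^ S.card * (1 - q K) ^ (n K - S.card)) Bad W shA shB Wsh δ) ↔
    Summable fun K => ∑ S ∈ (Finset.range (n K)).powerset, |q K ^ S.card * (1 - q K) ^ (n K - S.card) - p K ^ S.card * (1 - p K) ^ (n K - S.card)| := by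
  classical
  have hp' : ∀ K, 0 ≤ p K ∧ p K ≤ 1 := fun K => ⟨(hp K).1.le, (hp K).2.le⟩
  have hZA : ∀ (K : ℕ) (t : ℝ), |t| ≤ l₀ → 0 < ∑ S ∈ (Finset.range (n K)).powerset, p K ^ S.card * (1 - p K) ^ (n K - S.card) :=
    fun K t _ => by rw [sum_config_eq_one]; exact one_pos
  have hZB : ∀ (K : ℕ) (t : ℝ), |t| ≤ l₀ → 0 < ∑ S ∈ (Finset.range (n K)).powerset, q K ^ S.card * (1 - q K) ^ (n K - S.card) :=
    fun K t _ => by rw [sum_config_eq_one]; exact one_pos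
  have hl1 : ∀ K, ∑ S ∈ (Finset.range (n K)).powerset, |q K ^ S.card * (1 - q K) ^ (n K - S.card) - p K ^ S.card * (1 - p K) ^ (n K - S.card)| =
      2 * (∑ S ∈ (Finset.range (n K)).powerset.filter (fun S => p K ^ S.card * (1 - p K) ^ (n K - S.card) < q K ^ S.card * (1 - q K) ^ (n K - S.card)),
          q K ^ S.card * (1 - q K) ^ (n K - S.card) -
        ∑ S ∈ (Finset.range (n K)).powerset.filter (fun S => p K ^ S.card * (1 - p K) ^ (n K - S.card) < q K ^ S.card * (1 - q K) ^ (n K - S.card)),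
          p K ^ S.card * (1 - p K) ^ (n K - S.card)) := fun K =>
    sum_abs_sub_eq_two_mul_hahnGap (Finset.range (n K)).powerset (a := fun S => p K ^ S.card * (1 - p K) ^ (n K - S.card))
      (b := fun S => q K ^ S.card * (1 - q K) ^ (n K - S.card)) (by rw [sum_config_eq_one, sum_config_eq_one])
  constructor
  · rintro ⟨Bad, W, shA, shB, Wsh, δ, h⟩
    obtain ⟨ρ, hρ01, hρs, hρ⟩ := exists_tvRadius_of_hybridNE7 h hZA hZB
    refine Summable.of_nonneg_of_le (fun K => Finset.sum_nonneg fun S _ => abs_nonneg _) (fun K => ?_) (hρs.mul_left 2)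
    -- at the Hahn set the gap is `½ℓ¹ ≤ ρ_K`
    have hS : (Finset.range (n K)).powerset.filter (fun S => p K ^ S.card * (1 - p K) ^ (n K - S.card) < q K ^ S.card * (1 - q K) ^ (n K - S.card)) ⊆
        (Finset.range (n K)).powerset := Finset.filter_subset _ _
    have hK := hρ K 0 (by simpa using hl₀) _ hS
    simp only [sum_config_eq_one, div_one] at hK
    rw [hl1 K]
    rw [abs_sub_comm] at hK
    linarith [le_abs_self (∑ S ∈ (Finset.range (n K)).powerset.filter (fun S => p K ^ S.card * (1 - p K) ^ (n K - S.card) < q K ^ S.card * (1 - q K) ^ (n K - S.card)),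
        q K ^ S.card * (1 - q K) ^ (n K - S.card) -
      ∑ S ∈ (Finset.range (n K)).powerset.filter (fun S => p K ^ S.card * (1 - p K) ^ (n K - S.card) < q K ^ S.card * (1 - q K) ^ (n K - S.card)),
        p K ^ S.card * (1 - p K) ^ (n K - S.card))]
  · intro hsum
    -- the radius `ρ_K := ½ℓ¹_K`
    have hT : Target vol l₀ (fun _ => 0) (fun _ _ => (1 : ℝ)) := ⟨fun K => ⟨0, fun t _ => by simp⟩, summable_zero⟩
    obtain ⟨shA, shB, h⟩ := exists_hybridNE7_of_target_of_classLawTV (vol := vol) (T := fun K => (Finset.range (n K)).powerset)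
      (A := fun K _ S => p K ^ S.card * (1 - p K) ^ (n K - S.card)) (B := fun K _ S => q K ^ S.card * (1 - q K) ^ (n K - S.card)) hl₀
      (fun K t _ S _ => config_nonneg (hp' K).1 (hp' K).2 (n K) S) (fun K t _ S _ => config_nonneg (hq K).1 (hq K).2 (n K) S) hZA hZB
      (Z := fun _ _ => (1 : ℝ)) (fun K t _ => (sum_config_eq_one (p K) (n K)).symm) (fun K t _ => (sum_config_eq_one (q K) (n K)).symm) hT
      (ρ := fun K => (∑ S ∈ (Finset.range (n K)).powerset, |q K ^ S.card * (1 - q K) ^ (n K - S.card) - p K ^ S.card * (1 - p K) ^ (n K - S.card)|) / 2)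
      (fun K => div_nonneg (Finset.sum_nonneg fun S _ => abs_nonneg _) two_pos.le)
      (fun K => half_l1_config_lt_one (hp K).1 (hp K).2 (hq K).1 (hq K).2 (n K)) (hsum.div_const 2)
      (fun K t _ S hS => by
        have h := abs_sub_le_half_sum_abs (Finset.range (n K)).powerset (a := fun S => p K ^ S.card * (1 - p K) ^ (n K - S.card))
          (b := fun S => q K ^ S.card * (1 - q K) ^ (n K - S.card)) (by rw [sum_config_eq_one, sum_config_eq_one]) hS
        rw [sum_config_eq_one, sum_config_eq_one, div_one, div_one, abs_sub_comm]
        exact h)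
    exact ⟨fun _ _ => ∅, fun _ => 0, shA, shB, _, fun _ => 0, h⟩

/-- ★★ **THE FACE-TRIPLE EDITION** [folklore ∕ bookkeeping]: the same criterion for K3⁷ v5 stub 2's own conjunct shape `RelWeightBound ∧ ShellWeightBound ∧ (Core ∧ Summable δ)` (no `lt_one`):
(⇒) FILE C's `summable_classLawGap_of_faces` along the Hahn sets; (⇐) the bundled `HybridNE7` of the previous theorem projects onto the triple. -/
theorem faces_caricature_iff_summable_l1 (hp : ∀ K, 0 < p K ∧ p K < 1) (hq : ∀ K, 0 ≤ q K ∧ q K ≤ 1)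
    {l₀ : ℝ} (hl₀ : 0 ≤ l₀) (vol : ℝ) :
    (∃ (Bad : ℕ → ℝ → Finset (Finset ℕ)) (W : ℕ → ℝ) (shA shB : ℕ → ℝ → Finset ℕ → ℝ) (Wsh δ : ℕ → ℝ),
      RelWeightBound l₀ (fun K => (Finset.range (n K)).powerset) (fun K _ S => p K ^ S.card * (1 - p K) ^ (n K - S.card))
        (fun K _ S => q K ^ S.card * (1 - q K) ^ (n K - S.card)) Bad W ∧
      ShellWeightBound l₀ (fun K => (Finset.range (n K)).powerset) (fun K _ S => p K ^ S.card * (1 - p K) ^ (n K - S.card))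
        (fun K _ S => q K ^ S.card * (1 - q K) ^ (n K - S.card)) shA shB Wsh ∧
      (Core l₀ vol (fun K => (Finset.range (n K)).powerset) Bad (fun K t S => p K ^ S.card * (1 - p K) ^ (n K - S.card) - shA K t S)
        (fun K t S => q K ^ S.card * (1 - q K) ^ (n K - S.card) - shB K t S) δ ∧ Summable δ)) ↔
    Summable fun K => ∑ S ∈ (Finset.range (n K)).powerset, |q K ^ S.card * (1 - q K) ^ (n K - S.card) - p K ^ S.card * (1 - p K) ^ (n K - S.card)| := by
  classical
  constructor
  · rintro ⟨Bad, W, shA, shB, Wsh, δ, hW, hSh, hcore, hδ⟩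
    have hpos : ∀ (K : ℕ) (t : ℝ), |t| ≤ l₀ → 0 < ∑ τ ∈ (Finset.range (n K)).powerset, p K ^ τ.card * (1 - p K) ^ (n K - τ.card) :=
      fun K t _ => by rw [sum_config_eq_one]; exact one_pos
    have ht0 : ∀ K : ℕ, |(fun _ : ℕ => (0 : ℝ)) K| ≤ l₀ := fun _ => by simpa using hl₀
    -- the Hahn sets, one per `K`
    set H : ℕ → Finset (Finset ℕ) := fun K =>
      (Finset.range (n K)).powerset.filter (fun S => p K ^ S.card * (1 - p K) ^ (n K - S.card) < q K ^ S.card * (1 - q K) ^ (n K - S.card)) with hH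
    have hHT : ∀ K, H K ⊆ (Finset.range (n K)).powerset := fun K => Finset.filter_subset _ _
    have hgap := summable_classLawGap_of_faces hW hSh hcore hδ hpos (fun _ => 0) ht0 H hHT
    refine Summable.of_nonneg_of_le (fun K => Finset.sum_nonneg fun S _ => abs_nonneg _) (fun K => ?_) (hgap.mul_left 2)
    have e := sum_abs_sub_eq_two_mul_hahnGap (Finset.range (n K)).powerset (a := fun S => p K ^ S.card * (1 - p K) ^ (n K - S.card))
      (b := fun S => q K ^ S.card * (1 - q K) ^ (n K - S.card)) (by rw [sum_config_eq_one, sum_config_eq_one])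
    simp only [sum_config_eq_one, div_one]
    rw [e]
    exact mul_le_mul_of_nonneg_left (le_abs_self _) two_pos.le
  · intro hsum
    obtain ⟨Bad, W, shA, shB, Wsh, δ, h⟩ := (exists_hybridNE7_caricature_iff_summable_l1 n p q hp hq hl₀ vol).2 hsum
    exact ⟨Bad, W, shA, shB, Wsh, δ, h.weight, h.shell, core_of_hybridNE7 h, h.summable⟩

end AlongK

/-! ## §4 The dictionary with the Hellinger road: the affinity defect `Δ_K = 1 − u_K^{n_K}` against the statistic `Λ_K`, two-sided; the summability letters coincide pairwise -/

section Dictionary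

variable {p q : ℝ}

/-- `Δ ≤ Λ∕2`: `1 − u^n ≤ n(1 − u) ≤ n·Λ₁∕2` (Bernoulli's inequality, FILE A's upper defect). [folklore] -/
theorem one_sub_affinity_pow_le_half_stat (hp0 : 0 ≤ p) (hq0 : 0 ≤ q) (hp1 : p ≤ 1) (hq1 : q ≤ 1) (n : ℕ) :
    1 - (Real.sqrt (p * q) + Real.sqrt ((1 - p) * (1 - q))) ^ n ≤ n * ((q - p) ^ 2 / (p + q) + (q - p) ^ 2 / (2 - p - q)) / 2 := by
  set u := Real.sqrt (p * q) + Real.sqrt ((1 - p) * (1 - q)) with hu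
  have hB := one_add_mul_le_pow (show (-2 : ℝ) ≤ u - 1 by linarith [affinity₁_nonneg p q]) n
  rw [add_sub_cancel] at hB
  have hdef := one_sub_affinity₁_le_stat_div_two hp0 hq0 hp1 hq1
  rw [← hu] at hdef
  have hn : (0 : ℝ) ≤ n := Nat.cast_nonneg n
  nlinarith

/-- `1 − e^{−Λ∕4} ≤ Δ`: `u ≤ 1 − Λ₁∕4 ≤ e^{−Λ₁∕4}`, so `u^n ≤ e^{−Λ∕4}` (FILE A's lower defect, `1 + x ≤ eˣ`). [folklore] -/
theorem one_sub_exp_neg_le_defect (hp0 : 0 ≤ p) (hq0 : 0 ≤ q) (hp1 : p ≤ 1) (hq1 : q ≤ 1) (n : ℕ) :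
    1 - Real.exp (-(n * ((q - p) ^ 2 / (p + q) + (q - p) ^ 2 / (2 - p - q))) / 4) ≤ 1 - (Real.sqrt (p * q) + Real.sqrt ((1 - p) * (1 - q))) ^ n := by
  set u := Real.sqrt (p * q) + Real.sqrt ((1 - p) * (1 - q)) with hu
  set L := (q - p) ^ 2 / (p + q) + (q - p) ^ 2 / (2 - p - q) with hL
  have hdef := stat_div_four_le_one_sub_affinity₁ hp0 hq0 hp1 hq1
  rw [← hu, ← hL] at hdef
  have hu0 : 0 ≤ u := affinity₁_nonneg p q
  have h1 : u ^ n ≤ (1 - L / 4) ^ n := pow_le_pow_left₀ hu0 (by linarith) n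
  have h2 : (1 - L / 4) ^ n ≤ Real.exp (-(L / 4)) ^ n :=
    pow_le_pow_left₀ (by linarith) (by linarith [Real.add_one_le_exp (-(L / 4))]) n
  have h3 : Real.exp (-(L / 4)) ^ n = Real.exp (-(n * L) / 4) := by
    rw [← Real.exp_nat_mul]; congr 1; ring
  linarith

variable (n : ℕ → ℕ) (p q : ℕ → ℝ) (Λ : ℕ → ℝ)

/-- ★ **`Σ_K Δ_K < ∞ ⟺ Σ_K Λ_K < ∞`** [folklore]: on the caricature the Hellinger road's NECESSITY letter «`Σ(1 − bc_K) < ∞`» and FILE C's «`Σ Λ_K < ∞`» are ONE letter. -/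
theorem summable_defect_iff_summable_stat (hp : ∀ K, 0 ≤ p K ∧ p K ≤ 1) (hq : ∀ K, 0 ≤ q K ∧ q K ≤ 1)
    (hΛ : ∀ K, Λ K = n K * ((q K - p K) ^ 2 / (p K + q K) + (q K - p K) ^ 2 / (2 - p K - q K))) :
    (Summable fun K => 1 - (Real.sqrt (p K * q K) + Real.sqrt ((1 - p K) * (1 - q K))) ^ n K) ↔ Summable Λ := by
  have hΛ0 : ∀ K, 0 ≤ Λ K := fun K => by
    rw [hΛ K]; exact mul_nonneg (Nat.cast_nonneg _) (stat₁_nonneg (hp K).1 (hq K).1 (hp K).2 (hq K).2)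
  have hΔ0 : ∀ K, 0 ≤ 1 - (Real.sqrt (p K * q K) + Real.sqrt ((1 - p K) * (1 - q K))) ^ n K := fun K => by
    have h := one_sub_exp_neg_le_defect (hp K).1 (hq K).1 (hp K).2 (hq K).2 (n K)
    rw [← hΛ K] at h
    have : Real.exp (-Λ K / 4) ≤ Real.exp 0 := Real.exp_le_exp.2 (by linarith [hΛ0 K])
    rw [Real.exp_zero] at this
    linarith
  constructor
  · intro hΔ
    -- `g_K := 1 − e^{−Λ_K∕4} ≤ Δ_K` is summable; eventually `Λ_K ≤ 4` and there `Λ_K∕8 ≤ g_K`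
    have hg : Summable fun K => 1 - Real.exp (-Λ K / 4) := by
      refine Summable.of_nonneg_of_le (fun K => ?_) (fun K => ?_) hΔ
      · have : Real.exp (-Λ K / 4) ≤ Real.exp 0 := Real.exp_le_exp.2 (by linarith [hΛ0 K])
        rw [Real.exp_zero] at this; linarith
      · have h := one_sub_exp_neg_le_defect (hp K).1 (hq K).1 (hp K).2 (hq K).2 (n K)
        rw [← hΛ K] at h
        exact h
    have hev : ∀ᶠ K in atTop, Λ K ≤ 4 := by
      have hc : (0 : ℝ) < 1 - Real.exp (-1) := by
        have : Real.exp (-1) < Real.exp 0 := Real.exp_lt_exp.2 (by norm_num)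
        rw [Real.exp_zero] at this; linarith
      filter_upwards [hg.tendsto_atTop_zero.eventually (gt_mem_nhds hc)] with K hK
      by_contra h4
      have : Real.exp (-Λ K / 4) ≤ Real.exp (-1) := Real.exp_le_exp.2 (by linarith [not_le.1 h4])
      linarith
    refine Summable.of_norm_bounded_eventually_nat (hg.mul_left 8) ?_
    filter_upwards [hev] with K hK
    rw [Real.norm_eq_abs, abs_of_nonneg (hΛ0 K)]
    have hx0 : 0 ≤ Λ K / 4 := by linarith [hΛ0 K]
    have h1 : Real.exp (-(Λ K / 4)) * (1 + Λ K / 4) ≤ 1 := by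
      calc Real.exp (-(Λ K / 4)) * (1 + Λ K / 4) ≤ Real.exp (-(Λ K / 4)) * Real.exp (Λ K / 4) :=
            mul_le_mul_of_nonneg_left (by linarith [Real.add_one_le_exp (Λ K / 4)]) (Real.exp_pos _).le
        _ = 1 := by rw [← Real.exp_add, neg_add_cancel, Real.exp_zero]
    have h : Λ K / 4 / 2 ≤ 1 - Real.exp (-(Λ K / 4)) := by nlinarith [Real.exp_pos (-(Λ K / 4))]
    have e : Real.exp (-(Λ K / 4)) = Real.exp (-Λ K / 4) := by congr 1; ring
    rw [e] at h
    linarith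
  · intro hΛs
    refine Summable.of_nonneg_of_le hΔ0 (fun K => ?_) (hΛs.div_const 2)
    rw [hΛ K]
    exact one_sub_affinity_pow_le_half_stat (hp K).1 (hq K).1 (hp K).2 (hq K).2 (n K)

/-- ★ **`Σ_K √Δ_K < ∞ ⟺ Σ_K √Λ_K < ∞`** [folklore]: on the caricature the Hellinger road's binding letter (V) «`Σ H_K < ∞`» (`H_K² = 1 − bc_K`) and FILE C's SUFFICIENCY letter «`Σ √Λ_K < ∞`»
are ONE letter — the ℓ¹ ∕ ℓ^{1∕2} squeeze of FILES B∕C is Le Cam's `H² ≤ TV ≤ √2·H` gap on the nose. -/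
theorem summable_sqrt_defect_iff_summable_sqrt_stat (hp : ∀ K, 0 ≤ p K ∧ p K ≤ 1) (hq : ∀ K, 0 ≤ q K ∧ q K ≤ 1)
    (hΛ : ∀ K, Λ K = n K * ((q K - p K) ^ 2 / (p K + q K) + (q K - p K) ^ 2 / (2 - p K - q K))) :
    (Summable fun K => Real.sqrt (1 - (Real.sqrt (p K * q K) + Real.sqrt ((1 - p K) * (1 - q K))) ^ n K)) ↔ Summable fun K => Real.sqrt (Λ K) := by
  have hΛ0 : ∀ K, 0 ≤ Λ K := fun K => by
    rw [hΛ K]; exact mul_nonneg (Nat.cast_nonneg _) (stat₁_nonneg (hp K).1 (hq K).1 (hp K).2 (hq K).2)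
  have hlow : ∀ K, 1 - Real.exp (-Λ K / 4) ≤ 1 - (Real.sqrt (p K * q K) + Real.sqrt ((1 - p K) * (1 - q K))) ^ n K := fun K => by
    have h := one_sub_exp_neg_le_defect (hp K).1 (hq K).1 (hp K).2 (hq K).2 (n K)
    rw [← hΛ K] at h
    exact h
  constructor
  · intro hΔ
    -- `√Δ_K → 0` ⇒ `Δ_K → 0` ⇒ eventually `Λ_K ≤ 4`; there `Λ_K∕8 ≤ Δ_K`, so `√Λ_K ≤ √8·√Δ_K`
    have h0 := hΔ.tendsto_atTop_zero
    have hev : ∀ᶠ K in atTop, Λ K ≤ 4 := by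
      have hc : (0 : ℝ) < Real.sqrt (1 - Real.exp (-1)) := Real.sqrt_pos.2 (by
        have : Real.exp (-1) < Real.exp 0 := Real.exp_lt_exp.2 (by norm_num)
        rw [Real.exp_zero] at this; linarith)
      filter_upwards [h0.eventually (gt_mem_nhds hc)] with K hK
      by_contra h4
      have h5 : Real.exp (-Λ K / 4) ≤ Real.exp (-1) := Real.exp_le_exp.2 (by linarith [not_le.1 h4])
      have h6 : 1 - Real.exp (-1) ≤ 1 - (Real.sqrt (p K * q K) + Real.sqrt ((1 - p K) * (1 - q K))) ^ n K := by linarith [hlow K]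
      exact absurd hK (not_lt.2 (Real.sqrt_le_sqrt h6))
    refine Summable.of_norm_bounded_eventually_nat (hΔ.mul_left (Real.sqrt 8)) ?_
    filter_upwards [hev] with K hK
    rw [Real.norm_eq_abs, abs_of_nonneg (Real.sqrt_nonneg _), ← Real.sqrt_mul (by norm_num : (0 : ℝ) ≤ 8)]
    refine Real.sqrt_le_sqrt ?_
    have h1 : Real.exp (-(Λ K / 4)) * (1 + Λ K / 4) ≤ 1 := by
      calc Real.exp (-(Λ K / 4)) * (1 + Λ K / 4) ≤ Real.exp (-(Λ K / 4)) * Real.exp (Λ K / 4) :=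
            mul_le_mul_of_nonneg_left (by linarith [Real.add_one_le_exp (Λ K / 4)]) (Real.exp_pos _).le
        _ = 1 := by rw [← Real.exp_add, neg_add_cancel, Real.exp_zero]
    have hx0 : 0 ≤ Λ K / 4 := by linarith [hΛ0 K]
    have h : Λ K / 4 / 2 ≤ 1 - Real.exp (-(Λ K / 4)) := by nlinarith [Real.exp_pos (-(Λ K / 4))]
    have e : Real.exp (-(Λ K / 4)) = Real.exp (-Λ K / 4) := by congr 1; ring
    rw [e] at h
    linarith [hlow K]
  · intro hΛs
    refine Summable.of_nonneg_of_le (fun K => Real.sqrt_nonneg _) (fun K => Real.sqrt_le_sqrt ?_) hΛs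
    have h := one_sub_affinity_pow_le_half_stat (hp K).1 (hq K).1 (hp K).2 (hq K).2 (n K)
    rw [← hΛ K] at h
    linarith [hΛ0 K]

end Dictionary

end Summit.QuantumFields.YangMills.BalabanUVNodes.N20BlockCaricatureExactCriterion

end
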